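import Literature.Computability.Complexity.RandomKSatThreshold
import HarnessLib

/-!
# Random `k`-SAT: monotonicity in `m`, and the reduction of the Achlioptas–Peres lower bound to
# "uniformly positive probability" plus a sharp threshold sequence

Everything in this file is PROVED; it is the bookkeeping layer of the proof of
`AchlioptasPeres2004_threshold_lower_bound` (`RandomKSatThreshold.lean`: the with-replacement
literal-array model `F_k(n, m)`, probabilities as counting ratios `litArraySatProb k n m`).
Sources:

* E. Friedgut, *Sharp thresholds of graph properties, and the `k`-sat problem* (with an appendix
  by J. Bourgain), J. Amer. Math. Soc. 12 (1999) 1017–1054 [Friedgut1999], **Theorem 1.3**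
  (p. 1020): *"For every fixed `k ≥ 2` there exists a function `c(n)` such that for every `ε > 0`,
  `P_k(c - ε) → 1`, `P_k(c + ε) → 0`"*, where (p. 1019) a random formula with parameter `c`
  consists of `cn` clauses chosen uniformly from all `2^k n^k` clauses (ordered `k`-tuples of
  literals, improper clauses allowed — the clause space `Fin k → Fin n × Bool` of
  `RandomKSatThreshold.lean`) and `P_k(c)` is the probability that it is satisfiable; §5 (p. 1040)
  draws the `M = cn` clauses without repetition and passes to the binomial model.
* D. Achlioptas, Y. Peres, J. Amer. Math. Soc. 17 (2004) [AchlioptasPeres2004], **Theorem 3**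
  (arXiv:cs/0305009 p. 2), the form in which the theorem is used for the `2^k log 2 - O(k)` lower
  bound and the form taken as a HYPOTHESIS here: in THEIR model `F_k(n, m)` (`m` i.i.d. uniform clauses, i.e.
  with replacement; footnote †/§3 p. 8: "our results hold in all common models for random `k`-SAT")
  *"For each `k ≥ 2`, there exists a sequence `r_k(n)` such that for every `ε > 0`,
  `lim_{n→∞} P[F_k(n, rn) is satisfiable] = 1` if `r = (1-ε) r_k(n)` and `= 0` if
  `r = (1+ε) r_k(n)`."* (multiplicative window; equivalent to Friedgut's additive window because
  `r_k(n)` is bounded between two positive constants, AP §1.1), and its **Corollary 1** (p. 3):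
  *"Fix `k ≥ 2`. If `F_k(n, rn)` is satisfiable with uniformly positive probability then
  `r_k ≥ r`"*, `r_k = sup{r : F_k(n, rn)` satisfiable w.h.p.`}`.

## What is here (all proved)

* API of the model: `litArraySatProb_nonneg`, `litArraySatProb_le_one`,
  `litArraySatProb_zero_right` (the empty formula is satisfiable: probability `1`),
  `card_filter_litArraySat_succ_le` / `litArraySatProb_succ_le` / `litArraySatProb_antitone`
  (**monotonicity in the number of clauses**: dropping the first clause of a satisfiable array
  leaves a satisfiable array, and the map `Φ ↦ (Φ 0, tail Φ)` is injective, so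
  `#sat_{m+1} ≤ (2n)^k · #sat_m`).
* **Corollary 1** of AP2004 relative to a sharp threshold sequence `r_k(·)` for the given `k`
  (the conclusion of AP2004 Thm. 3 = Friedgut 1999 Thm. 1.3 at that `k`:
  `Pr[F_k(n, ⌊(1-ε) r_k(n) n⌋) sat] → 1`, `Pr[F_k(n, ⌊(1+ε) r_k(n) n⌋) sat] → 0` for all `ε > 0`,
  an explicit HYPOTHESIS — Friedgut's theorem, that such a sequence exists for every `k ≥ 2`, is a
  deep result NOT asserted anywhere in this file),
  `tendsto_one_of_uniformlyPos_of_sharpThresholdSeq`: if `Pr[F_k(n, ⌊rn⌋) sat] ≥ c > 0` for all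
  large `n`, then `Pr[F_k(n, ⌊r'n⌋) sat] → 1` for every `r' < r` — i.e. `r_k ≥ r` in the
  rendering of `RandomKSatThreshold.lean`.
* `achlioptasPeres2004_threshold_lower_bound_of_uniformlyPos` — the final bookkeeping of the proof
  of Theorem 2: sharp thresholds for all `k ≥ 2` + uniformly positive satisfiability probability
  for `k ≥ k₀`, `r < ρ_k` with `L_k - ρ_k → 0` (`L_k = 2^k log 2 - (k+1) log 2/2 - 1`) imply
  `AchlioptasPeres2004_threshold_lower_bound` (with `δ_k := L_k - ρ_k` for `k ≥ k₀` and
  `δ_k := 2^k log 2`, a vacuous bound, below `k₀`). The second-moment input `hpos` (AP §§3–9) and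
  Friedgut's theorem `hF` are exactly what remains.

Not here: Friedgut's general coarse-threshold criterion (Thm. 1.1/1.2, Bourgain's appendix), the
`k = 2` constant threshold `r_2 = 1` (Chvátal–Reed, Goerdt), the convergence of `r_k(n)`
(Ding–Sly–Sun 2022 for `k ≥ k₀`; open in general).
-/

noncomputable section

namespace Literature.Computability.Complexity

open Finset Filter
open scoped Classical Topology

/-! ### Basic API of `litArraySatProb` -/

/-- `Pr[F_k(n, m) satisfiable] ≥ 0` (a ratio of cardinalities). [folklore] -/
theorem litArraySatProb_nonneg (k n m : ℕ) : 0 ≤ litArraySatProb k n m := by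
  unfold litArraySatProb; positivity

/-- `Pr[F_k(n, m) satisfiable] ≤ 1` (a sub-finset has smaller cardinality; `0/0 = 0 ≤ 1` in the
junk case). [folklore] -/
theorem litArraySatProb_le_one (k n m : ℕ) : litArraySatProb k n m ≤ 1 := by
  unfold litArraySatProb
  apply div_le_one_of_le₀ _ (Nat.cast_nonneg _)
  rw [← Finset.card_univ]
  exact_mod_cast Finset.card_filter_le _ _

/-- The empty formula `F_k(n, 0)` is satisfiable with probability `1` (any assignment, even the
empty one for `n = 0`, satisfies all zero clauses). [folklore] -/
theorem litArraySatProb_zero_right (k n : ℕ) : litArraySatProb k n 0 = 1 := by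
  unfold litArraySatProb
  have h : (univ.filter fun Φ : Fin 0 → Fin k → Fin n × Bool => LitArraySat Φ) = univ := by
    apply Finset.filter_true_of_mem
    intro Φ _
    exact ⟨fun _ => true, fun i => i.elim0⟩
  rw [h, Finset.card_univ]
  have hpos : (0 : ℝ) < Fintype.card (Fin 0 → Fin k → Fin n × Bool) := by
    exact_mod_cast Fintype.card_pos
  exact div_self hpos.ne'

/-- Dropping the first clause of a satisfiable literal array leaves a satisfiable array.
[folklore] -/
theorem LitArraySat.tail {m k n : ℕ} {Φ : Fin (m + 1) → Fin k → Fin n × Bool}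
    (h : LitArraySat Φ) : LitArraySat (Fin.tail Φ) := by
  obtain ⟨σ, hσ⟩ := h
  exact ⟨σ, fun i => hσ i.succ⟩

/-- **Counting form of monotonicity in `m`**: `#{Φ ∈ F_k(n, m+1) sat} ≤ (2n)^k · #{Φ ∈ F_k(n, m) sat}`
(the map `Φ ↦ (Φ 0, tail Φ)` is injective and sends satisfiable arrays into
`(clauses) × (satisfiable arrays)`). [cite: AchlioptasPeres2004, §1 p. 1 (monotone model); Friedgut1999, §5 p. 1040 ("f is a monotone decreasing function of M")] -/
theorem card_filter_litArraySat_succ_le (k n m : ℕ) :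
    ((univ.filter fun Φ : Fin (m + 1) → Fin k → Fin n × Bool => LitArraySat Φ).card : ℝ) ≤
      Fintype.card (Fin k → Fin n × Bool) *
        (univ.filter fun Φ : Fin m → Fin k → Fin n × Bool => LitArraySat Φ).card := by
  set X := Fin k → Fin n × Bool
  have h1 : (univ.filter fun Φ : Fin (m + 1) → X => LitArraySat Φ).card ≤
      (univ.filter fun p : X × (Fin m → X) => LitArraySat p.2).card := by
    refine Finset.card_le_card_of_injOn (fun Φ => (Φ 0, Fin.tail Φ)) ?_ ?_
    · intro Φ hΦ
      simp only [Finset.coe_filter, Finset.mem_univ, true_and, Set.mem_setOf_eq] at hΦ ⊢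
      exact hΦ.tail
    · intro Φ _ Ψ _ hΦΨ
      simp only [Prod.mk.injEq] at hΦΨ
      rw [← Fin.cons_self_tail Φ, ← Fin.cons_self_tail Ψ, hΦΨ.1, hΦΨ.2]
  have h2 : (univ.filter fun p : X × (Fin m → X) => LitArraySat p.2) =
      (univ : Finset X) ×ˢ (univ.filter fun Φ : Fin m → X => LitArraySat Φ) := by
    ext p
    simp only [Finset.mem_filter, Finset.mem_univ, true_and, Finset.mem_product]
  rw [h2, Finset.card_product, Finset.card_univ] at h1
  exact_mod_cast h1

/-- **Monotonicity of `Pr[F_k(n, m) sat]` in `m`** (one step): adding a clause can only destroy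
satisfiability. (If the clause space is empty, `n = 0 < k`, the left side is the junk `0`.)
[cite: Friedgut1999, §5 p. 1040] -/
theorem litArraySatProb_succ_le (k n m : ℕ) :
    litArraySatProb k n (m + 1) ≤ litArraySatProb k n m := by
  have hmain := card_filter_litArraySat_succ_le k n m
  unfold litArraySatProb
  set X := Fin k → Fin n × Bool
  set N₁ : ℝ := ((univ.filter fun Φ : Fin (m + 1) → X => LitArraySat Φ).card : ℝ)
  set N₀ : ℝ := ((univ.filter fun Φ : Fin m → X => LitArraySat Φ).card : ℝ)
  have hcard : (Fintype.card (Fin (m + 1) → X) : ℝ) =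
      Fintype.card X * Fintype.card (Fin m → X) := by
    simp only [X, Fintype.card_fun, Fintype.card_fin]
    push_cast; ring
  rcases (Nat.cast_nonneg (Fintype.card X) : (0 : ℝ) ≤ _).eq_or_lt with h0 | hpos
  · have hz : (Fintype.card (Fin (m + 1) → X) : ℝ) = 0 := by rw [hcard, ← h0, zero_mul]
    rw [hz, div_zero]
    positivity
  · have hX : Nonempty X := Fintype.card_pos_iff.mp (by exact_mod_cast hpos)
    have hD : (0 : ℝ) < Fintype.card (Fin m → X) := by exact_mod_cast Fintype.card_pos
    calc N₁ / Fintype.card (Fin (m + 1) → X)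
        = N₁ / (Fintype.card X * Fintype.card (Fin m → X)) := by rw [hcard]
      _ ≤ (Fintype.card X * N₀) / (Fintype.card X * Fintype.card (Fin m → X)) :=
          div_le_div_of_nonneg_right hmain (by positivity)
      _ = N₀ / Fintype.card (Fin m → X) := mul_div_mul_left _ _ hpos.ne'

/-- **`m ↦ Pr[F_k(n, m) sat]` is non-increasing.** [cite: Friedgut1999, §5 p. 1040] -/
theorem litArraySatProb_antitone (k n : ℕ) : Antitone (litArraySatProb k n) :=
  antitone_nat_of_succ_le (litArraySatProb_succ_le k n)

/-! ### Corollary 1: a sharp threshold sequence upgrades "uniformly positive" to "w.h.p." -/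

/-- **Achlioptas–Peres 2004, Corollary 1** (arXiv:cs/0305009 p. 3: *"Fix `k ≥ 2`. If `F_k(n, rn)`
is satisfiable with uniformly positive probability then `r_k ≥ r`"*), PROVED relative to a sharp
threshold sequence `r_k(·)` for this `k` — the conclusion of AP2004 Thm. 3 = Friedgut 1999 Thm. 1.3
at this `k` (`Pr[F_k(n, ⌊(1∓ε) r_k(n) n⌋) sat] → 1` resp. `→ 0` for every `ε > 0`), taken as the
hypothesis `hrk`; Friedgut's theorem itself is NOT asserted in this file:
if `Pr[F_k(n, ⌊rn⌋) sat] ≥ c > 0` for all large `n`, then `Pr[F_k(n, ⌊r'n⌋) sat] → 1` for every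
`r' < r`. Proof ("immediate", loc. cit.): if `(1+ε) r_k(n) < r` frequently, monotonicity in `m`
and the `→ 0` half contradict `Pr ≥ c`; so eventually `r ≤ (1+ε) r_k(n)`, whence
`r' ≤ (1-ε) r_k(n)` once `(1+ε) r' ≤ (1-ε) r`, and the `→ 1` half plus monotonicity squeeze.
[cite: AchlioptasPeres2004, Cor. 1 (arXiv:cs/0305009 p. 3)] -/
theorem tendsto_one_of_uniformlyPos_of_sharpThresholdSeq {k : ℕ} {rk : ℕ → ℝ}
    (hrk : ∀ ε : ℝ, 0 < ε →
      Tendsto (fun n : ℕ => litArraySatProb k n ⌊(1 - ε) * rk n * n⌋₊) atTop (𝓝 1) ∧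
      Tendsto (fun n : ℕ => litArraySatProb k n ⌊(1 + ε) * rk n * n⌋₊) atTop (𝓝 0))
    {r r' c : ℝ} (hr' : r' < r)
    (hc : 0 < c) (hpos : ∀ᶠ n : ℕ in atTop, c ≤ litArraySatProb k n ⌊r * n⌋₊) :
    Tendsto (fun n : ℕ => litArraySatProb k n ⌊r' * n⌋₊) atTop (𝓝 1) := by
  by_cases hr'0 : r' < 0
  · have hfl : ∀ n : ℕ, ⌊r' * n⌋₊ = 0 := fun n =>
      Nat.floor_of_nonpos (mul_nonpos_of_nonpos_of_nonneg hr'0.le (Nat.cast_nonneg n))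
    simp only [hfl, litArraySatProb_zero_right]
    exact tendsto_const_nhds
  push Not at hr'0
  have hr0 : 0 < r := lt_of_le_of_lt hr'0 hr'
  set ε := (r - r') / (2 * (r + r')) with hε
  have hε0 : 0 < ε := div_pos (by linarith) (by linarith)
  have hεmul : ε * (2 * (r + r')) = r - r' := by
    rw [hε]; field_simp
  have hε1 : ε ≤ 1 / 2 := by nlinarith
  have hkey : (1 + ε) * r' ≤ (1 - ε) * r := by nlinarith
  obtain ⟨h1, h0⟩ := hrk ε hε0
  -- Step 1: eventually `r ≤ (1+ε) r_k(n)`.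
  have hev : ∀ᶠ n : ℕ in atTop, r ≤ (1 + ε) * rk n := by
    by_contra hcon
    rw [Filter.not_eventually] at hcon
    have hlt : ∀ᶠ n : ℕ in atTop, litArraySatProb k n ⌊(1 + ε) * rk n * n⌋₊ < c :=
      h0.eventually (eventually_lt_nhds hc)
    obtain ⟨n, hn1, hn2, hn3⟩ := (hcon.and_eventually (hlt.and hpos)).exists
    have hmono : litArraySatProb k n ⌊r * n⌋₊ ≤
        litArraySatProb k n ⌊(1 + ε) * rk n * n⌋₊ := by
      apply litArraySatProb_antitone
      apply Nat.floor_le_floor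
      exact mul_le_mul_of_nonneg_right (le_of_lt (not_le.mp hn1)) (Nat.cast_nonneg n)
    linarith
  -- Step 2: then `r' ≤ (1-ε) r_k(n)` eventually, and monotonicity + the `→ 1` half squeeze.
  have hlow : ∀ᶠ n : ℕ in atTop,
      litArraySatProb k n ⌊(1 - ε) * rk n * n⌋₊ ≤ litArraySatProb k n ⌊r' * n⌋₊ := by
    filter_upwards [hev] with n hn
    apply litArraySatProb_antitone
    apply Nat.floor_le_floor
    apply mul_le_mul_of_nonneg_right _ (Nat.cast_nonneg n)
    have h1e : 0 < 1 + ε := by linarith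
    have h2 : (1 + ε) * r' ≤ (1 + ε) * ((1 - ε) * rk n) :=
      calc (1 + ε) * r' ≤ (1 - ε) * r := hkey
        _ ≤ (1 - ε) * ((1 + ε) * rk n) := mul_le_mul_of_nonneg_left hn (by linarith)
        _ = (1 + ε) * ((1 - ε) * rk n) := by ring
    exact le_of_mul_le_mul_left h2 h1e
  exact tendsto_of_tendsto_of_tendsto_of_le_of_le' h1 tendsto_const_nhds hlow
    (Eventually.of_forall fun n => litArraySatProb_le_one k n _)

/-! ### Reduction of Theorem 2 to "uniformly positive probability below `ρ_k`" plus sharp thresholds -/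

/-- **The shape of the proof of Achlioptas–Peres 2004, Theorem 2** (arXiv:cs/0305009 pp. 15–16:
second moment ⇒ uniformly positive probability for `r ≤ ρ_k`, `k ≥ k₀`; "Lemma 1 and Corollary 1
then imply `r_k ≥ r`"; `δ_k := L_k - ρ_k → 0`, and `δ_k` arbitrary for the finitely many `k < k₀`),
PROVED as a reduction: IF every `k ≥ 2` has a sharp satisfiability threshold sequence (Friedgut's
theorem, hypothesis `hF`) and IF for all `k ≥ k₀` and all `r < ρ_k` the formula `F_k(n, ⌊rn⌋)` is
satisfiable with uniformly positive probability (hypothesis `hpos`), where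
`2^k log 2 - (k+1) log 2 / 2 - 1 - ρ_k → 0` (hypothesis `hρ`), THEN
`AchlioptasPeres2004_threshold_lower_bound` holds. (For `3 ≤ k < k₀` take
`δ_k := 2^k log 2`, making the density bound negative and the formula empty.)
[cite: AchlioptasPeres2004, proof of Thm. 2 (arXiv:cs/0305009 pp. 15–16)] -/
theorem achlioptasPeres2004_threshold_lower_bound_of_uniformlyPos
    (hF : ∀ k : ℕ, 2 ≤ k → ∃ rk : ℕ → ℝ, ∀ ε : ℝ, 0 < ε →
      Tendsto (fun n : ℕ => litArraySatProb k n ⌊(1 - ε) * rk n * n⌋₊) atTop (𝓝 1) ∧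
      Tendsto (fun n : ℕ => litArraySatProb k n ⌊(1 + ε) * rk n * n⌋₊) atTop (𝓝 0))
    (ρ : ℕ → ℝ) (k₀ : ℕ)
    (hpos : ∀ k : ℕ, k₀ ≤ k → ∀ r : ℝ, r < ρ k →
      ∃ c : ℝ, 0 < c ∧ ∀ᶠ n : ℕ in atTop, c ≤ litArraySatProb k n ⌊r * n⌋₊)
    (hρ : Tendsto (fun k : ℕ => 2 ^ k * Real.log 2 - ((k : ℝ) + 1) * Real.log 2 / 2 - 1 - ρ k)
      atTop (𝓝 0)) :
    AchlioptasPeres2004_threshold_lower_bound := by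
  set L : ℕ → ℝ := fun k => 2 ^ k * Real.log 2 - ((k : ℝ) + 1) * Real.log 2 / 2 - 1 with hL
  refine ⟨fun k => if k < k₀ then 2 ^ k * Real.log 2 else L k - ρ k, ?_, ?_⟩
  · -- `δ_k = L_k - ρ_k` for `k ≥ k₀`, which tends to `0`
    apply hρ.congr'
    filter_upwards [eventually_ge_atTop k₀] with k hk
    simp only [not_lt.mpr hk, if_false, hL]
  · intro k hk r hr
    by_cases hk₀ : k < k₀
    · -- vacuous range: the bound is negative, the formula is empty
      simp only [hk₀, if_true] at hr
      have hlog : 0 < Real.log 2 := Real.log_pos one_lt_two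
      have hr0 : r < 0 := by
        have : 0 ≤ ((k : ℝ) + 1) * Real.log 2 / 2 := by positivity
        linarith
      have hfl : ∀ n : ℕ, ⌊r * n⌋₊ = 0 := fun n =>
        Nat.floor_of_nonpos (mul_nonpos_of_nonpos_of_nonneg hr0.le (Nat.cast_nonneg n))
      simp only [hfl, litArraySatProb_zero_right]
      exact tendsto_const_nhds
    · simp only [hk₀, if_false, hL] at hr
      have hrρ : r < ρ k := by linarith
      obtain ⟨r'', hr'', hρ''⟩ := exists_between hrρ
      obtain ⟨c, hc, hcpos⟩ := hpos k (not_lt.mp hk₀) r'' hρ''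
      obtain ⟨rk, hrk⟩ := hF k (by omega)
      exact tendsto_one_of_uniformlyPos_of_sharpThresholdSeq hrk hr'' hc hcpos

end Literature.Computability.Complexity

end
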